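import Summits.AtomisticToContinuum.HydrodynamicLimit.Theorems.JParityClosureRateFloorLineDefs
import HarnessLib

/-!
# Crux `EnergyCurrentTails` (stmt-AtomisticToContinuum-9235), line `quartic-schur-ledger`:
# the FIRST-PARTNER objects (seat c6, reshape B)

Route-posited objects (pure definitions, no new mathematics) through which the line's open LOWER
primitive — the lagged kinetic-window quartic mixing floor QMF₄ᴸ (`QuarticMixingFloor4L` below; registered
stub `stub_quarticMixingFloor4L` of the crux workfile `Cruxes/EnergyCurrentTails/Lines/quartic_schur_ledger.lean`)
— is split into a STATIC MESOSCOPIC floor under the fixed-time law, a short-window disturbance ceiling, and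
sure kinematics.  They are filed here, in a reviewed objects file, so that the registered stubs of the
split can be stated BY NAME (their inline texts exceed the registry's signature budget) and landed under
`Theorems/` verbatim.  Everything is built on the landed would-be / realised pair vocabulary of
`Theorems.RateFloorLine` (`wouldBePairs`, `firstContact`, `realisedPairs`; file
`JParityClosureRateFloorLineDefs.lean`) over the library's hard-sphere prelude on `𝕋³`.

For `N + 1` spheres of diameter `ε = ε_N = σ(N+1)^{-1/3}`, a look-ahead `Δ > 0`, thresholds `K₀, K₁`:

* `mixMark N K₀ K₁` — the QUARTIC MIXING MARK of an ordered pair read at a (predicted or actual) contact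
  datum `(x, y, v, w)` (positions at contact, INCOMING velocities): `𝟙{K₀ < ‖v‖, ‖w‖ ≤ K₁} · (N+1)⁻¹ ·
  2‖v′‖²‖w′‖²`, `(v′, w′) = reflectVel (sepVec x y) (v, w)` the outgoing velocities — the Povzner gain of a
  lab-fast first participant off a thermal partner (the mark of QMF₄ᴸ's right-hand side, with the partner
  cut `‖w‖ ≤ K₁` added; dropping the cut only increases it);
* `firstPairs ε Δ z ⊆ wouldBePairs ε Δ z` — the ordered would-be pairs `(i, j)` of the configuration `z`
  whose predicted free-flight contact time is MINIMAL among the would-be pairs issued from `i`: `j` is a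
  FIRST free-flight partner of `i` within the look-ahead `Δ` (ties allowed);
* `pairSum`, `firstPartnerSum`, `realisedFirstSum` — marked sums over a pair set / the first pairs / the
  first pairs that are REALISED along a curve `γ` (no endpoint takes part in a collision strictly before
  the predicted contact), marks at the predicted datum exactly as in `RateFloorLine.wouldBeSum`;
* `fastQuarticAvg N K₀ y = (N+1)⁻¹ Σᵢ 𝟙{K₀ < ‖vᵢ‖}‖vᵢ‖⁴` — the cut-off empirical quartic moment (QMF₄ᴸ's
  left integrand);
* `mixingFlux Φ K₀ S z` — the `ℝ≥0∞`-valued collision functional of QMF₄ᴸ's right-hand side over the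
  time set `S` (mixing marks of the realised collisions, cut-off on the incoming speed of the first
  participant, no partner cut);
* the statements `FirstPartnerFloor` (T: static mesoscopic tube-occupation floor under `λ_r` — OPEN),
  `FirstPartnerDisturbanceCeiling` (I: short-window disturbance ceiling — OPEN),
  `FirstPartnerPathwise` (P: realised first-partner marks are collision marks — sure kinematics, provable
  from the landed `RateFloorMarkedTransfer.stub_markedTransfer` / `RateFloorRealisedDatum.stub_realisedDatum`),
  `WindowMixingRateFloor` (W: the anchored short-window rate floor) and `QuarticMixingFloor4L` (QMF₄ᴸ
  verbatim), composed in the crux workfile as `T → I → P → W` and `W → QMF₄ᴸ` (offset averaging).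

What is deliberately NOT here: any theorem about these objects.

References: Gallagher–Saint-Raymond–Texier 2013 §4.1 (collision cylinders on hard-sphere trajectories);
Cercignani–Illner–Pulvirenti 1994 §4.2 (Povzner marks); elementary.
-/

noncomputable section

open scoped BigOperators Classical ENNReal InnerProductSpace
open MeasureTheory Set
open Literature.Analysis.FluidPDE Literature.MathematicalPhysics.KineticTheory

namespace Summit.AtomisticToContinuum.HydrodynamicLimit.Theorems

namespace EnergyCurrentTailsFirstPartner

open RateFloorLine

variable {n : ℕ}

/-- The QUARTIC MIXING MARK of an ordered pair at a contact datum: positions `x, y` at contact, INCOMING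
velocities `v, w`; value `𝟙{K₀ < ‖v‖ ∧ ‖w‖ ≤ K₁} · (N+1)⁻¹ · 2‖v′‖²‖w′‖²` with `(v′, w′)` the outgoing
velocities of the elastic reflection along the separation vector (the time argument is ignored; it is there
to fit the mark signature of `RateFloorLine.wouldBeSum`). -/
def mixMark (N : ℕ) (K₀ K₁ : ℝ) : ℝ → T3 → T3 → V3 → V3 → ℝ :=
  fun _ x y v w =>
    if K₀ < ‖v‖ ∧ ‖w‖ ≤ K₁ then
      ((N + 1 : ℕ) : ℝ)⁻¹ *
        (2 * (‖(reflectVel ((Torus.geometry (Fin 3)).sepVec x y) (v, w)).1‖ ^ 2 *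
          ‖(reflectVel ((Torus.geometry (Fin 3)).sepVec x y) (v, w)).2‖ ^ 2))
    else 0

/-- The FIRST would-be pairs of a configuration for the look-ahead `Δ`: ordered would-be pairs `(i, j)` whose
predicted contact time is minimal among the would-be pairs `(i, ·)` (the first free-flight partner(s) of
`i`). -/
def firstPairs (ε Δ : ℝ) (z : Config n (Fin 3) T3) : Finset (Fin n × Fin n) :=
  (wouldBePairs ε Δ z).filter fun p =>
    ∀ q ∈ wouldBePairs ε Δ z, q.1 = p.1 → firstContact ε Δ z p ≤ firstContact ε Δ z q

/-- The marked sum over a set `S` of ordered pairs of the configuration `z` (window start `s`), each mark read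
at the PREDICTED datum: predicted contact time, free-flight positions there, window-start velocities (the
summand of `RateFloorLine.wouldBeSum`). -/
def pairSum (ε Δ : ℝ) (z : Config n (Fin 3) T3) (s : ℝ) (F : ℝ → T3 → T3 → V3 → V3 → ℝ)
    (S : Finset (Fin n × Fin n)) : ℝ :=
  ∑ p ∈ S,
    F (s + firstContact ε Δ z p) (freeFlight (Torus.geometry (Fin 3)) (firstContact ε Δ z p) z p.1).1
      (freeFlight (Torus.geometry (Fin 3)) (firstContact ε Δ z p) z p.2).1 ((z p.1).2) ((z p.2).2)

/-- The FIRST-PARTNER SUM: the marked sum over the first would-be pairs (a STATIC functional of the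
configuration). -/
def firstPartnerSum (ε Δ : ℝ) (z : Config n (Fin 3) T3) (s : ℝ) (F : ℝ → T3 → T3 → V3 → V3 → ℝ) : ℝ :=
  pairSum ε Δ z s F (firstPairs ε Δ z)

/-- The REALISED FIRST-PARTNER SUM of the window `(s, s + Δ]` along the curve `γ`: the marked sum over the
first would-be pairs of `γ s` that are realised (no endpoint participates in a collision strictly between `s`
and the predicted contact time). -/
def realisedFirstSum (ε Δ : ℝ) (γ : ℝ → Config n (Fin 3) T3) (s : ℝ)
    (F : ℝ → T3 → T3 → V3 → V3 → ℝ) : ℝ :=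
  pairSum ε Δ (γ s) s F (firstPairs ε Δ (γ s) ∩ realisedPairs ε Δ γ s)

/-- The cut-off empirical quartic moment `(N+1)⁻¹ Σᵢ 𝟙{K₀ < ‖vᵢ‖} ‖vᵢ‖⁴` of a configuration. -/
def fastQuarticAvg (N : ℕ) (K₀ : ℝ) (y : Config (N + 1) (Fin 3) T3) : ℝ :=
  ((N + 1 : ℕ) : ℝ)⁻¹ * ∑ i : Fin (N + 1), if K₀ < ‖(y i).2‖ then ‖(y i).2‖ ^ 4 else 0

/-- The MIXING FLUX of the orbit of `z` over the time set `S`: the `ℝ≥0∞`-valued sum over the collisions with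
time in `S` and over the ordered contact pairs `(i, j)` of the marks `𝟙{K₀ < ‖vᵢ⁻‖} (N+1)⁻¹ 2‖vᵢ⁺‖²‖vⱼ⁺‖²`
(`vᵢ⁻` the incoming velocity recovered by `collidePair`, `v⁺` the outgoing ones read on the orbit) — the
right-hand functional of the quartic mixing floors QMF₄ / QMF₄ᴸ. -/
def mixingFlux {N : ℕ} {ε : ℝ} (Φ : HardSphereFlow (Torus.geometry (Fin 3)) ε (N + 1)) (K₀ : ℝ)
    (S : Set ℝ) (z : Config (N + 1) (Fin 3) T3) : ℝ≥0∞ :=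
  ∑ᶠ τ ∈ collisionTimes (Torus.geometry (Fin 3)) ε (fun r => Φ.flow r z) ∩ S,
    ∑ i : Fin (N + 1), ∑ j : Fin (N + 1), if i = j then (0 : ℝ≥0∞) else
      (contactSet (Torus.geometry (Fin 3)) (N + 1) ε i j).indicator
        (fun y => if K₀ < ‖((collidePair (Torus.geometry (Fin 3)) i j y) i).2‖ then
          ENNReal.ofReal (((N + 1 : ℕ) : ℝ)⁻¹ * (2 * (‖(y i).2‖ ^ 2 * ‖(y j).2‖ ^ 2))) else 0)
        (Φ.flow τ z)

/-! ## The statements of reshape B (Props; composed in the crux workfile, proved or promoted elsewhere) -/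

/-- **T · FIRST-PARTNER FLOOR** (static, mesoscopic; OPEN primitive).  Along the flow from local Gibbs data,
for every horizon and flow family there are thresholds `K₀ ≥ 0`, `K₁`, a look-ahead bound `τ₀ > 0`, a rate
`c > 0` and `N₀` such that for `N ≥ N₀`, every look-ahead `0 < Δ ≤ τ₀ (N+1)^{-1/3}` and every time
`r ∈ [0, T]`: `c · σ²(N+1)^{1/3} · Δ · E[fastQuarticAvg] ≤ E[firstPartnerSum]` under the time-`r` law — in
the ‖v‖⁴-weighted mean a lab-fast sphere has, with probability at least `c ×` (collision clock × look-ahead),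
a THERMAL first free-flight partner within the look-ahead whose predicted encounter mixes (no empty corridor
ahead of it at the mesoscopic scale `Δ‖v − w‖ ≫ ε`).  A statement about the (1+1)-body structure of the
evolved law at ONE time; beyond entropy (the fast spheres are a vanishing fraction). -/
def FirstPartnerFloor : Prop :=
  ∀ (a₀ θ₀ : T3 → ℝ) (u₀ : T3 → V3), Continuous a₀ → Continuous θ₀ → Continuous u₀ →
    (∀ x, 0 < a₀ x) → (∀ x, 0 < θ₀ x) →
    ∃ σ₀ : ℝ, 0 < σ₀ ∧ ∀ σ : ℝ, 0 < σ → σ < σ₀ → ∀ T : ℝ, 0 < T →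
      ∀ Φ : ((N : ℕ) → HardSphereFlow (Torus.geometry (Fin 3)) (hsDiameter σ N) (N + 1)),
        ∃ K₀ : ℝ, 0 ≤ K₀ ∧ ∃ K₁ : ℝ, ∃ τ₀ : ℝ, 0 < τ₀ ∧ ∃ c : ℝ, 0 < c ∧ ∃ N₀ : ℕ, ∀ N : ℕ, N₀ ≤ N →
          ∀ Δ : ℝ, 0 < Δ → Δ ≤ τ₀ * ((N : ℝ) + 1) ^ (-(1 / 3 : ℝ)) → ∀ r : ℝ, 0 ≤ r → r ≤ T →
            ENNReal.ofReal (c * (σ ^ 2 * ((N + 1 : ℕ) : ℝ) ^ ((1 : ℝ) / 3)) * Δ) *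
                (∫⁻ z, ENNReal.ofReal (fastQuarticAvg N K₀ ((Φ N).flow r z))
                  ∂(localGibbsLaw σ a₀ u₀ θ₀ N (Φ N))) ≤
              ∫⁻ z, ENNReal.ofReal
                  (firstPartnerSum (hsDiameter σ N) Δ ((Φ N).flow r z) r (mixMark N K₀ K₁))
                ∂(localGibbsLaw σ a₀ u₀ θ₀ N (Φ N))

/-- **I · FIRST-PARTNER DISTURBANCE CEILING** (short window; OPEN primitive, a CEILING of Enskog type with one
rare participant).  For all thresholds `K₀, K₁` there are `τ₀ > 0`, `C ≥ 0`, `N₀` such that for `N ≥ N₀`,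
`0 < Δ ≤ τ₀ (N+1)^{-1/3}` and `0 ≤ r`, `r + Δ ≤ T`:
`E[firstPartnerSum] ≤ 2 · E[realisedFirstSum] + C (σ²(N+1)^{1/3} Δ)² · E[fastQuarticAvg]` (time-`r`
configuration, realisation along the orbit over `(r, r + Δ]`) — in the mark-weighted mean at least half of the
first free-flight encounters predicted at time `r` happen undisturbed (neither sphere is hit by a third one
before the predicted contact), up to a second-order slack.  Pathwise `firstPartnerSum = realisedFirstSum +
(disturbed part)`; the disturbed part needs a THIRD sphere to collide, within the look-ahead, with the thermal
partner or (itself freshly deflected) with the fast sphere: rate `≲ σ²(N+1)^{1/3}Δ (1 + K₁)` per first pair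
under one-sided chaos. -/
def FirstPartnerDisturbanceCeiling : Prop :=
  ∀ (a₀ θ₀ : T3 → ℝ) (u₀ : T3 → V3), Continuous a₀ → Continuous θ₀ → Continuous u₀ →
    (∀ x, 0 < a₀ x) → (∀ x, 0 < θ₀ x) →
    ∃ σ₀ : ℝ, 0 < σ₀ ∧ ∀ σ : ℝ, 0 < σ → σ < σ₀ → ∀ T : ℝ, 0 < T →
      ∀ Φ : ((N : ℕ) → HardSphereFlow (Torus.geometry (Fin 3)) (hsDiameter σ N) (N + 1)),
        ∀ K₀ K₁ : ℝ, ∃ τ₀ : ℝ, 0 < τ₀ ∧ ∃ C : ℝ, 0 ≤ C ∧ ∃ N₀ : ℕ, ∀ N : ℕ, N₀ ≤ N →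
          ∀ Δ : ℝ, 0 < Δ → Δ ≤ τ₀ * ((N : ℝ) + 1) ^ (-(1 / 3 : ℝ)) → ∀ r : ℝ, 0 ≤ r → r + Δ ≤ T →
            (∫⁻ z, ENNReal.ofReal
                (firstPartnerSum (hsDiameter σ N) Δ ((Φ N).flow r z) r (mixMark N K₀ K₁))
              ∂(localGibbsLaw σ a₀ u₀ θ₀ N (Φ N))) ≤
              2 * (∫⁻ z, ENNReal.ofReal
                  (realisedFirstSum (hsDiameter σ N) Δ (fun u => (Φ N).flow u z) r (mixMark N K₀ K₁))
                ∂(localGibbsLaw σ a₀ u₀ θ₀ N (Φ N))) +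
                ENNReal.ofReal (C * (σ ^ 2 * ((N + 1 : ℕ) : ℝ) ^ ((1 : ℝ) / 3) * Δ) ^ 2) *
                  (∫⁻ z, ENNReal.ofReal (fastQuarticAvg N K₀ ((Φ N).flow r z))
                    ∂(localGibbsLaw σ a₀ u₀ θ₀ N (Φ N)))

/-- **P · FIRST-PARTNER PATHWISE TRANSFER** (sure kinematics on the good set; provable now from
`RateFloorMarkedTransfer.stub_markedTransfer` and `RateFloorRealisedDatum.stub_realisedDatum`).  For
`0 < σ < 1/2`, every flow, every good initial datum, thresholds and look-ahead `Δ > 0`: the realised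
first-partner marks predicted at time `r` are bounded by the mixing flux of the orbit over `(r, r + Δ]` (a
realised would-be pair collides at the predicted time with the predicted incoming velocities and impact
geometry; distinct realised pairs are distinct collisions; the partner cut only decreases the mark). -/
def FirstPartnerPathwise : Prop :=
  ∀ (σ : ℝ), 0 < σ → σ < 1 / 2 →
    ∀ (N : ℕ) (Φ : HardSphereFlow (Torus.geometry (Fin 3)) (hsDiameter σ N) (N + 1))
      (z : Config (N + 1) (Fin 3) T3), z ∈ Φ.good → ∀ (K₀ K₁ r Δ : ℝ), 0 < Δ →
        ENNReal.ofReal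
            (realisedFirstSum (hsDiameter σ N) Δ (fun u => Φ.flow u z) r (mixMark N K₀ K₁)) ≤
          mixingFlux Φ K₀ (Set.Ioc r (r + Δ)) z

/-- **W · ANCHORED SHORT-WINDOW MIXING RATE FLOOR** (derived: `T → I → P → W` in the crux workfile).  For
every horizon and flow family there are `K₀ ≥ 0`, `τ₀ > 0`, `c > 0`, `N₀` such that for `N ≥ N₀`, every
look-ahead `0 < Δ ≤ τ₀ (N+1)^{-1/3}` and anchor `a ≥ 0` with `a + Δ ≤ T`: `c σ²(N+1)^{1/3} Δ · E[fastQuarticAvg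
at time a] ≤ E[mixingFlux over (a, a + Δ]]`. -/
def WindowMixingRateFloor : Prop :=
  ∀ (a₀ θ₀ : T3 → ℝ) (u₀ : T3 → V3), Continuous a₀ → Continuous θ₀ → Continuous u₀ →
    (∀ x, 0 < a₀ x) → (∀ x, 0 < θ₀ x) →
    ∃ σ₀ : ℝ, 0 < σ₀ ∧ ∀ σ : ℝ, 0 < σ → σ < σ₀ → ∀ T : ℝ, 0 < T →
      ∀ Φ : ((N : ℕ) → HardSphereFlow (Torus.geometry (Fin 3)) (hsDiameter σ N) (N + 1)),
        ∃ K₀ : ℝ, 0 ≤ K₀ ∧ ∃ τ₀ : ℝ, 0 < τ₀ ∧ ∃ c : ℝ, 0 < c ∧ ∃ N₀ : ℕ, ∀ N : ℕ, N₀ ≤ N →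
          ∀ Δ : ℝ, 0 < Δ → Δ ≤ τ₀ * ((N : ℝ) + 1) ^ (-(1 / 3 : ℝ)) → ∀ a : ℝ, 0 ≤ a → a + Δ ≤ T →
            ENNReal.ofReal (c * (σ ^ 2 * ((N + 1 : ℕ) : ℝ) ^ ((1 : ℝ) / 3)) * Δ) *
                (∫⁻ z, ENNReal.ofReal (fastQuarticAvg N K₀ ((Φ N).flow a z))
                  ∂(localGibbsLaw σ a₀ u₀ θ₀ N (Φ N))) ≤
              ∫⁻ z, mixingFlux (Φ N) K₀ (Set.Ioc a (a + Δ)) z ∂(localGibbsLaw σ a₀ u₀ θ₀ N (Φ N))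

/-- **QMF₄ᴸ · THE LAGGED KINETIC-WINDOW QUARTIC MIXING FLOOR** — verbatim the registered stub
`stub_quarticMixingFloor4L` of the crux workfile (seat c6 reshape A): one kinetic window `h_N = (N+1)^{-1/3}`
of mixing collisions pays for the ‖v‖⁴-content of the lab-fast spheres seen during its first half,
`c σ²(N+1)^{1/3} ∫_s^{s+h_N/2} E[fastQuarticAvg] ≤ E[mixingFlux over (s, s+h_N]]` (written out inline, as
registered). -/
def QuarticMixingFloor4L : Prop :=
  ∀ (a₀ θ₀ : T3 → ℝ) (u₀ : T3 → V3), Continuous a₀ → Continuous θ₀ → Continuous u₀ → (∀ x, 0 < a₀ x) → (∀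
    x, 0 < θ₀ x) → ∃ σ₀ : ℝ, 0 < σ₀ ∧ ∀ σ : ℝ, 0 < σ → σ < σ₀ → ∀ T : ℝ, 0 < T → ∀ Φ : ((N : ℕ) →
    HardSphereFlow (Torus.geometry (Fin 3)) (hsDiameter σ N) (N + 1)), ∃ K₀ : ℝ, 0 ≤ K₀ ∧ ∃ c : ℝ, 0 < c ∧ ∃
    N₀ : ℕ, ∀ N : ℕ, N₀ ≤ N → ∀ s : ℝ, 0 ≤ s → s + ((N : ℝ) + 1) ^ (-(1 / 3 : ℝ)) ≤ T → ENNReal.ofReal (c *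
    (σ ^ 2 * ((N + 1 : ℕ) : ℝ) ^ ((1 : ℝ) / 3))) * ∫⁻ τ in Set.Ioc s (s + ((N : ℝ) + 1) ^ (-(1 / 3 : ℝ)) /
    2), (∫⁻ z, ENNReal.ofReal (((N + 1 : ℕ) : ℝ)⁻¹ * ∑ i : Fin (N + 1), if K₀ < ‖(((Φ N).flow τ z) i).2‖
    then ‖(((Φ N).flow τ z) i).2‖ ^ 4 else 0) ∂(localGibbsLaw σ a₀ u₀ θ₀ N (Φ N))) ≤ ∫⁻ z, (∑ᶠ τ ∈
    collisionTimes (Torus.geometry (Fin 3)) (hsDiameter σ N) (fun r => (Φ N).flow r z) ∩ Set.Ioc s (s + ((N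
    : ℝ) + 1) ^ (-(1 / 3 : ℝ))), ∑ i : Fin (N + 1), ∑ j : Fin (N + 1), if i = j then (0 : ℝ≥0∞) else
    (contactSet (Torus.geometry (Fin 3)) (N + 1) (hsDiameter σ N) i j).indicator (fun y => if K₀ <
    ‖((collidePair (Torus.geometry (Fin 3)) i j y) i).2‖ then ENNReal.ofReal (((N + 1 : ℕ) : ℝ)⁻¹ * (2 *
    (‖(y i).2‖ ^ 2 * ‖(y j).2‖ ^ 2))) else 0) ((Φ N).flow τ z)) ∂(localGibbsLaw σ a₀ u₀ θ₀ N (Φ N))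

/-- Realised first pairs are first pairs (the index set of `realisedFirstSum` is contained in that of
`firstPartnerSum`). -/
theorem inter_realisedPairs_subset_firstPairs (ε Δ : ℝ) (γ : ℝ → Config n (Fin 3) T3) (s : ℝ) :
    firstPairs ε Δ (γ s) ∩ realisedPairs ε Δ γ s ⊆ firstPairs ε Δ (γ s) :=
  Finset.inter_subset_left

/-- First pairs are would-be pairs (registered one-line stub `firstPairs_subset_wouldBePairs` of the crux workfile,
so that this objects file lands attached to the crux item). -/
theorem firstPairs_subset_wouldBePairs :
    ∀ {n : ℕ} (ε Δ : ℝ) (z : Config n (Fin 3) T3), firstPairs ε Δ z ⊆ wouldBePairs ε Δ z :=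
  fun _ _ _ => Finset.filter_subset _ _

/-! ### Seat c6, second version of the split (the registered one): purely MESOSCOPIC floor, share-type ceiling

`FirstPartnerFloor` above asks ONE constant `c` for every look-ahead `Δ ≤ τ₀ h_N`, hence — letting `Δ ↓ 0` at fixed
`N` — a floor on the mark-weighted would-be CONTACT intensity of `λ_r` (pair structure at the scale `ε_N`).  The
composition only ever uses one look-ahead of a FIXED number `τ₁` of kinetic times.  The registered stubs therefore use
the three statements below (T′, I′, W′); `FirstPartnerFloor`, `FirstPartnerDisturbanceCeiling`, `WindowMixingRateFloor`
are kept as the first version (T ⟹ T′ for each `τ₁`; I′ is I without the second-order slack, with a free share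
constant `A`). -/

/-- **T′ · MESOSCOPIC FIRST-PARTNER FLOOR** (`FirstPartnerFloorMeso`; OPEN primitive, the registered stub
`stub_firstPartnerFloor`).  There are thresholds `K₀ ≥ 0`, `K₁` and `τ₀ > 0` such that for EVERY look-ahead ratio
`0 < τ₁ ≤ τ₀` (fixed before `N → ∞`) there are `c > 0`, `N₀` with, for `N ≥ N₀` and `r ∈ [0, T]`:
`c · σ²(N+1)^{1/3} · τ₁h_N · E[fastQuarticAvg] ≤ E[firstPartnerSum at look-ahead τ₁h_N]`, `h_N = (N+1)^{-1/3}` — in the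
‖v‖⁴-weighted mean a lab-fast sphere has, with probability ≥ `c τ₁ σ²`, a thermal first free-flight partner within `τ₁`
kinetic times whose predicted encounter mixes.  The look-ahead is a fixed fraction of the kinetic time, so the
statement lives at the MESOSCOPIC scale `τ₁h_N‖v − w‖` (≍ `τ₁/σ` diameters) and never at contact; `c` may degrade as
`τ₁ → 0` (no uniformity down to the contact scale is asked).  A statement about the (1+1)-body structure of the law
at ONE time; beyond entropy.  Why it might fail: empty corridors / co-moving platoons ahead of a positive
‖v‖⁴-fraction of the fast spheres at some time. -/
def FirstPartnerFloorMeso : Prop :=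
  ∀ (a₀ θ₀ : T3 → ℝ) (u₀ : T3 → V3), Continuous a₀ → Continuous θ₀ → Continuous u₀ →
    (∀ x, 0 < a₀ x) → (∀ x, 0 < θ₀ x) →
    ∃ σ₀ : ℝ, 0 < σ₀ ∧ ∀ σ : ℝ, 0 < σ → σ < σ₀ → ∀ T : ℝ, 0 < T →
      ∀ Φ : ((N : ℕ) → HardSphereFlow (Torus.geometry (Fin 3)) (hsDiameter σ N) (N + 1)),
        ∃ K₀ : ℝ, 0 ≤ K₀ ∧ ∃ K₁ : ℝ, ∃ τ₀ : ℝ, 0 < τ₀ ∧ ∀ τ₁ : ℝ, 0 < τ₁ → τ₁ ≤ τ₀ →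
          ∃ c : ℝ, 0 < c ∧ ∃ N₀ : ℕ, ∀ N : ℕ, N₀ ≤ N → ∀ r : ℝ, 0 ≤ r → r ≤ T →
            ENNReal.ofReal (c * (σ ^ 2 * ((N + 1 : ℕ) : ℝ) ^ ((1 : ℝ) / 3)) *
                (τ₁ * ((N : ℝ) + 1) ^ (-(1 / 3 : ℝ)))) *
                (∫⁻ z, ENNReal.ofReal (fastQuarticAvg N K₀ ((Φ N).flow r z))
                  ∂(localGibbsLaw σ a₀ u₀ θ₀ N (Φ N))) ≤
              ∫⁻ z, ENNReal.ofReal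
                  (firstPartnerSum (hsDiameter σ N) (τ₁ * ((N : ℝ) + 1) ^ (-(1 / 3 : ℝ)))
                    ((Φ N).flow r z) r (mixMark N K₀ K₁))
                ∂(localGibbsLaw σ a₀ u₀ θ₀ N (Φ N))

/-- **I′ · FIRST-PARTNER REALISED SHARE** (`FirstPartnerRealisedShare`; OPEN primitive, the registered stub
`stub_firstPartnerDisturbanceCeiling`; a short-window CEILING of Enskog type with one rare participant).  For all
thresholds `K₀, K₁` there are `τ₀ > 0`, a share constant `A ≥ 1` and `N₀` such that for `N ≥ N₀`, every look-ahead
`0 < Δ ≤ τ₀ h_N` and `0 ≤ r`, `r + Δ ≤ T`: `E[firstPartnerSum] ≤ A · E[realisedFirstSum]` (time-`r` configuration,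
realisation along the orbit over `(r, r + Δ]`) — in the mark-weighted mean at least the fraction `1/A` of the first
free-flight encounters predicted at time `r` within the look-ahead happen undisturbed (neither sphere is hit by a
third one before the predicted contact).  Pathwise `firstPartnerSum − realisedFirstSum` is the disturbed part; a
disturbance needs a THIRD sphere to collide, before the predicted contact (which comes after `≲ min(Δ, λ/‖v‖)`), with
the thermal partner or — itself freshly deflected — with the fast sphere: conditional probability
`≲ C · min(σ²τ₀, v_th/‖v‖)` under one-sided chaos, small once `τ₀` is.  Why it might fail: dynamical over-production
of three-body encounters (triple near-contacts) around fast spheres under the evolved law. -/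
def FirstPartnerRealisedShare : Prop :=
  ∀ (a₀ θ₀ : T3 → ℝ) (u₀ : T3 → V3), Continuous a₀ → Continuous θ₀ → Continuous u₀ →
    (∀ x, 0 < a₀ x) → (∀ x, 0 < θ₀ x) →
    ∃ σ₀ : ℝ, 0 < σ₀ ∧ ∀ σ : ℝ, 0 < σ → σ < σ₀ → ∀ T : ℝ, 0 < T →
      ∀ Φ : ((N : ℕ) → HardSphereFlow (Torus.geometry (Fin 3)) (hsDiameter σ N) (N + 1)),
        ∀ K₀ K₁ : ℝ, ∃ τ₀ : ℝ, 0 < τ₀ ∧ ∃ A : ℝ, 1 ≤ A ∧ ∃ N₀ : ℕ, ∀ N : ℕ, N₀ ≤ N →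
          ∀ Δ : ℝ, 0 < Δ → Δ ≤ τ₀ * ((N : ℝ) + 1) ^ (-(1 / 3 : ℝ)) → ∀ r : ℝ, 0 ≤ r → r + Δ ≤ T →
            (∫⁻ z, ENNReal.ofReal
                (firstPartnerSum (hsDiameter σ N) Δ ((Φ N).flow r z) r (mixMark N K₀ K₁))
              ∂(localGibbsLaw σ a₀ u₀ θ₀ N (Φ N))) ≤
              ENNReal.ofReal A * (∫⁻ z, ENNReal.ofReal
                  (realisedFirstSum (hsDiameter σ N) Δ (fun u => (Φ N).flow u z) r (mixMark N K₀ K₁))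
                ∂(localGibbsLaw σ a₀ u₀ θ₀ N (Φ N)))

/-- **W′ · ANCHORED ONE-LOOK-AHEAD MIXING RATE FLOOR** (`WindowMixingRateFloorOne`; derived: `T′ → I′ → P → W′` in
the crux workfile).  For every horizon and flow family there are `K₀ ≥ 0`, ONE look-ahead ratio `0 < τ₁ ≤ 1/4`,
`c > 0` and `N₀` such that for `N ≥ N₀` and every anchor `a ≥ 0` with `a + τ₁h_N ≤ T`:
`c σ²(N+1)^{1/3} τ₁h_N · E[fastQuarticAvg at time a] ≤ E[mixingFlux over (a, a + τ₁h_N]]`. -/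
def WindowMixingRateFloorOne : Prop :=
  ∀ (a₀ θ₀ : T3 → ℝ) (u₀ : T3 → V3), Continuous a₀ → Continuous θ₀ → Continuous u₀ →
    (∀ x, 0 < a₀ x) → (∀ x, 0 < θ₀ x) →
    ∃ σ₀ : ℝ, 0 < σ₀ ∧ ∀ σ : ℝ, 0 < σ → σ < σ₀ → ∀ T : ℝ, 0 < T →
      ∀ Φ : ((N : ℕ) → HardSphereFlow (Torus.geometry (Fin 3)) (hsDiameter σ N) (N + 1)),
        ∃ K₀ : ℝ, 0 ≤ K₀ ∧ ∃ τ₁ : ℝ, 0 < τ₁ ∧ τ₁ ≤ 1 / 4 ∧ ∃ c : ℝ, 0 < c ∧ ∃ N₀ : ℕ, ∀ N : ℕ, N₀ ≤ N →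
          ∀ a : ℝ, 0 ≤ a → a + τ₁ * ((N : ℝ) + 1) ^ (-(1 / 3 : ℝ)) ≤ T →
            ENNReal.ofReal (c * (σ ^ 2 * ((N + 1 : ℕ) : ℝ) ^ ((1 : ℝ) / 3)) *
                (τ₁ * ((N : ℝ) + 1) ^ (-(1 / 3 : ℝ)))) *
                (∫⁻ z, ENNReal.ofReal (fastQuarticAvg N K₀ ((Φ N).flow a z))
                  ∂(localGibbsLaw σ a₀ u₀ θ₀ N (Φ N))) ≤
              ∫⁻ z, mixingFlux (Φ N) K₀ (Set.Ioc a (a + τ₁ * ((N : ℝ) + 1) ^ (-(1 / 3 : ℝ)))) z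
                ∂(localGibbsLaw σ a₀ u₀ θ₀ N (Φ N))

end EnergyCurrentTailsFirstPartner

end Summit.AtomisticToContinuum.HydrodynamicLimit.Theorems

end
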